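import Literature.Probability.FitznerVanDerHofstad2017.NobleCodingLevelOne
import Literature.Probability.FitznerVanDerHofstad2017.NobleCodingLevelZero
import Literature.Probability.FitznerVanDerHofstad2017.NobleBoundingEventsF
import HarnessLib

/-!
# [FvdH17] §4.4 (4.59)–(4.64): the CODING of a middle level `i ∈ {1,…,N-1}` — the walks behind
# `F = F′ ∪ F″ ∪ F‴`, inside `C̃_i`, with the cross-level clauses, PROVED

Source: R. Fitzner, R. van der Hofstad, *Mean-field behavior for nearest-neighbor percolation in
`d > 10`*, Electron. J. Probab. **22** (2017) no. 43 [FvdH17]; arXiv:1506.07977v2 (equation numbers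
agree in both versions).

* (4.59)–(4.62) (arXiv v2 p. 41 = EJP p. 38): the events `F′`, `F″`, `F‴` of level `i` and `F = F′ ∪ F″ ∪ F‴`
  (typed verbatim as `NobleBoundingEvents.eventF1/2/3`, `eventF`).
* (4.64) and the paragraph after it (v2 pp. 42–43): "`E′(b̄_{i-1}, b̲_i; C̃_{i-1})_i ∩ {z_{i+1} ∈ C̃_i}
  ⊂ ⋃_{z_i ∈ C̃_{i-1}} ⋃_{t_i,w_i} F(b_{i-1},t_i,z_i,b_i,w_i,z_{i+1})_i` … Since this sausage is cut through by
  `C̃_{i-1}`, all connections contain an element of `C̃_{i-1}` … we identify `w_i` to be the last vertex of the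
  path `b̄_{i-1} ⟶ z_{i+1}` that lies on the sausage or on the path `b̄_{i-1} ⟶ t_i`; depending on its position we
  obtain `F′`, `F″` or `F‴`."
* the paragraph after (4.65) (v2 p. 43): "we can choose `z_i` such that there exists a path from `w_{i-1}` to
  `z_i` in `C̃_{i-1}` that intersects `C̃_i` only at its endpoint `z_i` … In this case, all paths involved in the
  above connections are bond disjoint, even when they occur in different levels."

What this module proves (deterministic graph combinatorics on one configuration `ω ⊆` bonds of `ℤ^d`;
`A` = the previous cluster `C̃_{i-1}` (with the adjoined vertex), `(y, y') = b_i`, `z' = z_{i+1}`):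

* `exists_sausage_sdiff` — the entry route and the two routes of the last sausage of `E′(v, y; A)`, chosen as in
  `NobleCodingLevelOne.exists_lastPivot` (entry route `A`-free except at its end `t`, meeting the sausage only
  at `t`), all three AVOIDING the bond `b_i = (y, y')` when `y' ∉ C̃_i = C̃^{(y,y')}(v)`, hence open walks of the
  restricted configuration `ω ∖ {(y,y')}` — i.e. inside `C̃_i`; with the SEPARATION clause of the last
  pivotal bond (every `t–y` path meets the entry route only at `t`; rev. 2);
* `LaceCodingMidE` / `LaceCodingMidS` — the CODING of a middle level: six pairwise edge-disjoint walks, open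
  in `ω ∖ {(y,y')}`, realising `F′`/`F″` (`w_i` on the entry route: `v → w → t`, `t → z → y`, `t → y`,
  `w → z'`) resp. `F‴` (`w_i` on the sausage route opposite to `z_i`: `v → t`, `t → z → y`, `t → w → y`,
  `w → z'`), WITH the clauses the typed events forget: `z ∈ A`; the walks `v → (w →) t` meet `A` at most in
  `t` and `t → z` meets `A` only in `z` (cross-level bond-disjointness, `disjoint_of_forall_mem`); the canonical
  identifications `z = y ↔ t = y` (both codings), `w ≠ t` unless `t = y` (`F″`), `z ≠ y ∧ t ≠ y` (`F‴`);
  the SHARPNESS clause of `F″` (rev. 2, field `sharp`): `t ≠ y → w ≠ y ∧ (w, y) closed` — the last pivotal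
  bond separates the exit vertex from the sausage, so the exit pair `(b̲_i, w_i)` has line class `2` on `F″`
  (this is what makes the `F″` pieces of (5.4) land on the `b = 2` rows only); the POSITION facts of
  rev. 3 (fields `yfreeE₁`, `nilF`, `yfreeE`, `yfreeZ₁`): the entry route and the first sausage piece do not
  pass through `b̲_i`, and on `F′` the sausage walks are trivial — used downstream to normalise an OPEN
  class-`1` bond (`(t_i, z_i)` or `(w_i, b̲_i)`) into the witness of its own line ([FvdH17] §6.1 "we include
  the information that either u, w and/or z, t are neighbors", v2 p. 59);
  and every vertex used lies in `C̃_i` (`mem_restrCluster`), which is what the NEXT level's off-`C̃_i` clause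
  is matched against;
* `exists_laceCodingMid` — existence for `ω ∈ E′(v,y;A)`, `y' ∉ C̃_i`, `z' ∈ C̃_i`; `exists_laceCoding_sdiff` —
  the four-walk coding of `NobleCodingLevelOne` inside `C̃_i` (levels whose successor junction carries no
  `w_i`-line); bridges `mem_eventF` to the typed `F` of (4.62) and the `nobleCell` wrappers.

Nothing in this module is a cited hypothesis; everything is kernel-proved for an arbitrary configuration.

## References
* [FvdH17] arXiv:1506.07977v2 §4.4 pp. 41–43 ((4.59)–(4.65) and the two paragraphs quoted); EJP 22 (2017) no. 43 pp. 38–41.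
* [HvdH17] M. Heydenreich, R. van der Hofstad, *Progress in high-dimensional percolation and random graphs*,
  Springer 2017, Def. 6.2–6.3, (6.2.11), (7.2.24) (the events `E′`, `C̃^{b}(x)`).
* [Diestel2017] R. Diestel, *Graph Theory*, 5th ed., Thm. 3.3.1 / Cor. 3.3.5(ii) (Menger, edge version) — via
  `LaceGraph.exists_two_edgeDisjoint_paths`.
-/

namespace Literature.Probability.FitznerVanDerHofstad2017

open Literature.Barriers.CriticalPhenomena Literature.Probability.Percolation
open Literature.Probability.LatticeModels Literature.Combinatorics.SimpleGraph _root_.SimpleGraph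

variable {d : ℕ}

/-! ### A. Open walks avoiding a bond are open walks of the restricted configuration -/

section Tools

variable {V : Type*}

/-- The bonds of an open walk not using `e` are bonds of the open graph of `ω ∖ {e}`. [folklore] -/
theorem edges_mem_edgeSet_sdiff {ω : BondConfig V} {a b : V} (q : (openGraph ω).Walk a b)
    {e : Sym2 V} (he : e ∉ q.edges) : ∀ e' ∈ q.edges, e' ∈ (openGraph (ω \ {e})).edgeSet := by
  intro e' he'
  have h1 : e' ∈ (openGraph ω).edgeSet := q.edges_subset_edgeSet he'
  change e' ∈ (SimpleGraph.fromEdgeSet ω).edgeSet at h1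
  change e' ∈ (SimpleGraph.fromEdgeSet (ω \ {e})).edgeSet
  rw [SimpleGraph.edgeSet_fromEdgeSet] at h1 ⊢
  refine ⟨⟨h1.1, fun h => ?_⟩, h1.2⟩
  rw [Set.mem_singleton_iff] at h
  rw [h] at he'
  exact he he'

/-- An open walk not using the bond `e`, read as an open walk of `ω ∖ {e}` (same vertices, same bonds).
[folklore] -/
def walkSdiff {ω : BondConfig V} {a b : V} (q : (openGraph ω).Walk a b) {e : Sym2 V}
    (he : e ∉ q.edges) : (openGraph (ω \ {e})).Walk a b :=
  q.transfer (openGraph (ω \ {e})) (edges_mem_edgeSet_sdiff q he)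

/-- Same bonds. [folklore] -/
@[simp] theorem edges_walkSdiff {ω : BondConfig V} {a b : V} (q : (openGraph ω).Walk a b) {e : Sym2 V}
    (he : e ∉ q.edges) : (walkSdiff q he).edges = q.edges :=
  Walk.edges_transfer _ _

/-- Same vertices. [folklore] -/
@[simp] theorem support_walkSdiff {ω : BondConfig V} {a b : V} (q : (openGraph ω).Walk a b) {e : Sym2 V}
    (he : e ∉ q.edges) : (walkSdiff q he).support = q.support :=
  Walk.support_transfer _ _

/-- A path stays a path. [folklore] -/
theorem isPath_walkSdiff {ω : BondConfig V} {a b : V} {q : (openGraph ω).Walk a b} {e : Sym2 V}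
    (he : e ∉ q.edges) (hq : q.IsPath) : (walkSdiff q he).IsPath :=
  hq.transfer _

/-- A walk all of whose `A`-vertices equal one fixed vertex has no bond with both endpoints in `A`; hence its
bonds are disjoint from any bond set all of whose bonds join two vertices of `A`. [folklore] -/
theorem disjoint_edges_of_forall_mem {G : _root_.SimpleGraph V} {A : Set V} {a b : V} (W : G.Walk a b)
    (c : V) (hW : ∀ x ∈ W.support, x ∈ A → x = c) {K : Set (Sym2 V)} (hK : ∀ e ∈ K, ∀ x ∈ e, x ∈ A) :
    Disjoint {e | e ∈ W.edges} K := by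
  refine Set.disjoint_left.2 fun e he heK => ?_
  induction e using Sym2.ind with
  | h x₁ x₂ =>
    have h₁ := hW x₁ (W.fst_mem_support_of_mem_edges he) (hK _ heK x₁ (Sym2.mem_mk_left _ _))
    have h₂ := hW x₂ (W.snd_mem_support_of_mem_edges he) (hK _ heK x₂ (Sym2.mem_mk_right _ _))
    exact (W.adj_of_mem_edges he).ne (h₁.trans h₂.symm)

end Tools

/-! ### B. Inside `C̃^{(y,y')}(v)`: walks of `ω ∖ {(y,y')}` and paths avoiding `(y,y')` -/

/-- Every vertex of an open walk of `ω ∖ {(y,y')}` starting in `C̃^{(y,y')}(v)` lies in `C̃^{(y,y')}(v)`.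
[cite: HeydenreichVanDerHofstad2017, Def. 6.3(b)] -/
theorem mem_restrCluster_of_walk_sdiff {ω : BondConfig (Site d)} {y y' v a b : Site d}
    (W : (openGraph (ω \ {s(y, y')})).Walk a b) (ha : a ∈ restrCluster y y' v ω) :
    ∀ x ∈ W.support, x ∈ restrCluster y y' v ω := by
  intro x hx
  obtain ⟨q, -, -⟩ := Walk.mem_support_iff_exists_append.1 hx
  rw [mem_restrCluster_iff] at ha ⊢
  exact ha.trans ⟨q⟩

/-- If `y' ∉ C̃^{(y,y')}(v)`, an open PATH from a vertex of `C̃^{(y,y')}(v)` to `y` does not use the bond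
`(y,y')`: the bond would be its last edge, traversed from `y'`, and the initial piece would put `y'` in
`C̃^{(y,y')}(v)`. [cite: FitznerVanDerHofstad2017, (3.25)–(3.27) (arXiv:1506.07977v2 pp. 25–27): the cell's condition `b̄_i ∉ C̃_i`] -/
theorem notMem_edges_of_notMem_restrCluster_of_mem {ω : BondConfig (Site d)} {v a y y' : Site d}
    (hy' : y' ∉ restrCluster y y' v ω) (ha : a ∈ restrCluster y y' v ω)
    (R : (openGraph ω).Walk a y) (hR : R.IsPath) : s(y, y') ∉ R.edges := by
  intro he
  have hne : y ≠ y' := (R.adj_of_mem_edges he).ne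
  obtain ⟨q, r, hqr⟩ := Walk.mem_support_iff_exists_append.1 (R.snd_mem_support_of_mem_edges he)
  have hq : s(y, y') ∉ q.edges := by
    intro heq
    rw [hqr] at hR
    obtain ⟨-, -, hmeet⟩ := LaceGraph.isPath_of_append hR
    exact hne (hmeet y (q.fst_mem_support_of_mem_edges heq) r.end_mem_support)
  rw [mem_restrCluster_iff] at ha
  exact hy' ((mem_restrCluster_iff y y' v y' ω).2 (ha.trans (reachable_sdiff_of_walk q hq)))

/-! ### C. The entry route and the last sausage, inside `C̃_i` -/

/-- **The last sausage of `E′(v, y; A)`, cut through by `A`, inside `C̃^{(y,y')}(v)`.**  For `ω ∈ E′(v,y;A)`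
(bonds of `ℤ^d`) with `y' ∉ C̃^{(y,y')}(v)` there are `t`, an entry route `W₁ : v → t` and two routes
`P, Q : t → y` of the last sausage — simple, pairwise edge-disjoint, OPEN IN `ω ∖ {(y,y')}` — such that `W₁` meets
`A` at most in `t`, each of `P`, `Q` meets `W₁` only in `t`, and each of `P`, `Q` contains a vertex of `A`
("since this sausage is cut through by `C̃_{i-1}`, all connections contain an element of `C̃_{i-1}`").
[cite: FitznerVanDerHofstad2017, §4.4 after (4.64) and after (4.65) (arXiv:1506.07977v2 pp. 42–43; EJP 22 (2017) no. 43 pp. 39–41)]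
[cite: HeydenreichVanDerHofstad2017, (6.2.11) and Def. 6.3] The last clause is the separation property of the last pivotal bond: every `t–y` path meets the entry
route `W₁` only at `t` (`NobleCodingLevelOne.exists_lastPivot` (c)). -/
theorem exists_sausage_sdiff {ω : BondConfig (Site d)} (hω : ω ⊆ (zdGraph d).edgeSet)
    {A : Set (Site d)} {v y y' : Site d} (hE : ω ∈ laceE A v y) (hy' : y' ∉ restrCluster y y' v ω) :
    ∃ (t : Site d) (W₁ : (openGraph (ω \ {s(y, y')})).Walk v t)
      (P Q : (openGraph (ω \ {s(y, y')})).Walk t y),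
      W₁.IsPath ∧ P.IsPath ∧ Q.IsPath ∧
      List.Disjoint W₁.edges P.edges ∧ List.Disjoint W₁.edges Q.edges ∧ List.Disjoint P.edges Q.edges ∧
      (∀ x ∈ W₁.support, x ∈ A → x = t) ∧
      (∀ x ∈ P.support, x ∈ W₁.support → x = t) ∧ (∀ x ∈ Q.support, x ∈ W₁.support → x = t) ∧
      (∃ x ∈ P.support, x ∈ A) ∧ (∃ x ∈ Q.support, x ∈ A) ∧
      (∀ R : (openGraph (ω \ {s(y, y')})).Walk t y, R.IsPath → ∀ x ∈ R.support, x ∈ W₁.support → x = t) := by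
  classical
  obtain ⟨⟨-, hnot⟩, -⟩ := (mem_laceE_iff A v y ω).1 hE
  obtain ⟨t, W₀, hW₀A, hcut, hW₀⟩ := exists_lastPivot hω hE
  -- pathify the entry route
  obtain ⟨W₁, hW₁p, hW₁A, hW₁⟩ : ∃ W₁ : (openGraph ω).Walk v t, W₁.IsPath ∧
      (∀ x ∈ W₁.support, x ∈ A → x = t) ∧
      ∀ R : (openGraph ω).Walk t y, R.IsPath → ∀ x ∈ R.support, x ∈ W₁.support → x = t :=
    ⟨W₀.bypass, W₀.bypass_isPath, fun x hx => hW₀A x (W₀.support_bypass_subset_support hx),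
      fun R hR x hxR hxW => hW₀ R hR x hxR (W₀.support_bypass_subset_support hxW)⟩
  -- Menger: two edge-disjoint routes of the last sausage `t ⇒ y`
  obtain ⟨p₀, hp₀⟩ := ((hcut s(y, y)).mono (openGraph_mono fun _ h => h.1)).symm.exists_isPath
  obtain ⟨P, Q, hP, hQ, hPQ⟩ := LaceGraph.exists_two_edgeDisjoint_paths p₀ hp₀ fun e _ =>
    exists_walk_of_reachable_sdiff (hcut e)
  -- both routes meet `A` (else `W₁ ++ R` joins `v` to `y` off `A`)
  have hmeet : ∀ R : (openGraph ω).Walk t y, ∃ x ∈ R.support, x ∈ A := by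
    intro R
    by_contra hcon
    push Not at hcon
    have htA : t ∉ A := hcon t R.start_mem_support
    refine hnot (openConnIn_of_walk (W₁.append R) fun x hx => ?_)
    rw [Walk.mem_support_append_iff] at hx
    rcases hx with hx | hx
    · exact fun hxA => htA (hW₁A x hx hxA ▸ hxA)
    · exact hcon x hx
  have h1P := hW₁ P hP
  have h1Q := hW₁ Q hQ
  -- none of the three routes uses the bond `(y, y')`
  have hW₁e : s(y, y') ∉ W₁.edges := by
    intro he
    have hyt : y = t := h1P y P.end_mem_support (W₁.fst_mem_support_of_mem_edges he)
    subst hyt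
    exact notMem_edges_of_notMem_restrCluster_of_mem hy' (self_mem_restrCluster _ _ _ _) W₁ hW₁p he
  have ht : t ∈ restrCluster y y' v ω :=
    (mem_restrCluster_iff y y' v t ω).2 (reachable_sdiff_of_walk W₁ hW₁e)
  have hPe := notMem_edges_of_notMem_restrCluster_of_mem hy' ht P hP
  have hQe := notMem_edges_of_notMem_restrCluster_of_mem hy' ht Q hQ
  refine ⟨t, walkSdiff W₁ hW₁e, walkSdiff P hPe, walkSdiff Q hQe, isPath_walkSdiff hW₁e hW₁p,
    isPath_walkSdiff hPe hP, isPath_walkSdiff hQe hQ, ?_, ?_, ?_, ?_, ?_, ?_, ?_, ?_, ?_⟩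
  · simpa using LaceGraph.edges_disjoint_of_support P W₁ h1P
  · simpa using LaceGraph.edges_disjoint_of_support Q W₁ h1Q
  · simpa using hPQ
  · simpa using hW₁A
  · simpa using h1P
  · simpa using h1Q
  · simpa using hmeet P
  · simpa using hmeet Q
  · intro R hR x hxR hxW
    have hle : openGraph (ω \ {s(y, y')}) ≤ openGraph ω := openGraph_mono fun _ h => h.1
    refine hW₁ (R.mapLe hle) ((Walk.isPath_mapLe hle).2 hR) x ?_ (by simpa using hxW)
    rwa [Walk.support_mapLe_eq_support]

/-! ### D. The two codings of a middle level -/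

section Coding

variable {V : Type*}

/-- **Middle-level coding, `w_i` on the entry route** (`F′` when `t = z = y`, `F″` otherwise): six pairwise
edge-disjoint open walks `E₁ : v → w`, `E₂ : w → t`, `Z₁ : t → z`, `X : t → y`, `Z₂ : z → y`, `L : w → z'`
(in this order they realise `{v↔w}∘{w↔t}∘{t↔z}∘{t↔y}∘{z↔y}∘{w↔z'}` of (4.60)), with `z ∈ A`, the entry walks
meeting `A` at most in `t`, `Z₁` meeting `A` only in `z`, and the canonical clauses `z = y ↔ t = y`,
`w ≠ t ∨ t = y`. [cite: FitznerVanDerHofstad2017, (4.59)–(4.60) and §4.4 after (4.64)/(4.65) (arXiv:1506.07977v2 pp. 41–43)] -/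
structure LaceCodingMidE (η : BondConfig V) (A : Set V) (v y t z w z' : V) where
  /-- `{b̄_{i-1} ↔ w_i}` along the entry route -/
  E₁ : (openGraph η).Walk v w
  /-- `{w_i ↔ t_i}`, the rest of the entry route -/
  E₂ : (openGraph η).Walk w t
  /-- `{t_i ↔ z_i}`: first sausage route up to its first `A`-vertex -/
  Z₁ : (openGraph η).Walk t z
  /-- `{t_i ↔ b̲_i}`: the second sausage route -/
  X : (openGraph η).Walk t y
  /-- `{z_i ↔ b̲_i}`: the rest of the first sausage route -/
  Z₂ : (openGraph η).Walk z y
  /-- `{w_i ↔ z_{i+1}}` -/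
  L : (openGraph η).Walk w z'
  dE₁E₂ : List.Disjoint E₁.edges E₂.edges
  dE₁Z₁ : List.Disjoint E₁.edges Z₁.edges
  dE₁X : List.Disjoint E₁.edges X.edges
  dE₁Z₂ : List.Disjoint E₁.edges Z₂.edges
  dE₁L : List.Disjoint E₁.edges L.edges
  dE₂Z₁ : List.Disjoint E₂.edges Z₁.edges
  dE₂X : List.Disjoint E₂.edges X.edges
  dE₂Z₂ : List.Disjoint E₂.edges Z₂.edges
  dE₂L : List.Disjoint E₂.edges L.edges
  dZ₁X : List.Disjoint Z₁.edges X.edges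
  dZ₁Z₂ : List.Disjoint Z₁.edges Z₂.edges
  dZ₁L : List.Disjoint Z₁.edges L.edges
  dXZ₂ : List.Disjoint X.edges Z₂.edges
  dXL : List.Disjoint X.edges L.edges
  dZ₂L : List.Disjoint Z₂.edges L.edges
  /-- `z_i ∈ C̃_{i-1}` -/
  mem : z ∈ A
  /-- the entry route meets `A` at most in `t` -/
  freeE₁ : ∀ x ∈ E₁.support, x ∈ A → x = t
  freeE₂ : ∀ x ∈ E₂.support, x ∈ A → x = t
  /-- `Z₁` meets `A` only in `z` -/
  freeZ₁ : ∀ x ∈ Z₁.support, x ∈ A → x = z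
  /-- canonical: the sausage is trivial iff its first `A`-vertex is `b̲_i` -/
  canon : z = y ↔ t = y
  /-- canonical: `w_i ≠ t_i` in `F″` -/
  ne : w ≠ t ∨ t = y
  /-- sharpness on `F″` (`t ≠ y`): the exit vertex `w` is not `y` and the bond `(w, y)` is closed — the last
  pivotal bond separates `w` from the last sausage, so the exit pair `(y, w)` has line class `2`. -/
  sharp : t ≠ y → w ≠ y ∧ s(w, y) ∉ η
  /-- (rev. 3) `E₁` does not pass through `b̲_i` (unless `w_i = b̲_i`): the entry route is simple and meets the
  sausage only in `t_i`. Used to normalise an open class-`1` bond `(w_i, b̲_i)` onto `E₂` on `F′`. -/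
  yfreeE₁ : w ≠ y → y ∉ E₁.support
  /-- (rev. 3) on `F′` (`t = z = b̲_i`) the three sausage walks carry no bond. -/
  nilF : t = y → Z₁.edges = [] ∧ X.edges = [] ∧ Z₂.edges = []

/-- **Middle-level coding, `w_i` on the sausage** (`F‴`): six pairwise edge-disjoint open walks `E : v → t`,
`Z₁ : t → z`, `X₁ : t → w`, `Z₂ : z → y`, `X₂ : w → y`, `L : w → z'` (realising
`{v↔t}∘{t↔z}∘{t↔w}∘{z↔y}∘{w↔y}∘{w↔z'}` of (4.61)), `z` and `w` on opposite routes, with `z ∈ A`, `E` meeting `A`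
at most in `t`, `Z₁` meeting `A` only in `z`, and `z ≠ y`, `t ≠ y`.
[cite: FitznerVanDerHofstad2017, (4.61) and §4.4 after (4.64)/(4.65) (arXiv:1506.07977v2 pp. 41–43)] -/
structure LaceCodingMidS (η : BondConfig V) (A : Set V) (v y t z w z' : V) where
  /-- `{b̄_{i-1} ↔ t_i}`, the entry route -/
  E : (openGraph η).Walk v t
  /-- `{t_i ↔ z_i}`: first sausage route up to its first `A`-vertex -/
  Z₁ : (openGraph η).Walk t z
  /-- `{t_i ↔ w_i}` along the second sausage route -/
  X₁ : (openGraph η).Walk t w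
  /-- `{z_i ↔ b̲_i}` -/
  Z₂ : (openGraph η).Walk z y
  /-- `{w_i ↔ b̲_i}` -/
  X₂ : (openGraph η).Walk w y
  /-- `{w_i ↔ z_{i+1}}` -/
  L : (openGraph η).Walk w z'
  dEZ₁ : List.Disjoint E.edges Z₁.edges
  dEX₁ : List.Disjoint E.edges X₁.edges
  dEZ₂ : List.Disjoint E.edges Z₂.edges
  dEX₂ : List.Disjoint E.edges X₂.edges
  dEL : List.Disjoint E.edges L.edges
  dZ₁X₁ : List.Disjoint Z₁.edges X₁.edges
  dZ₁Z₂ : List.Disjoint Z₁.edges Z₂.edges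
  dZ₁X₂ : List.Disjoint Z₁.edges X₂.edges
  dZ₁L : List.Disjoint Z₁.edges L.edges
  dX₁Z₂ : List.Disjoint X₁.edges Z₂.edges
  dX₁X₂ : List.Disjoint X₁.edges X₂.edges
  dX₁L : List.Disjoint X₁.edges L.edges
  dZ₂X₂ : List.Disjoint Z₂.edges X₂.edges
  dZ₂L : List.Disjoint Z₂.edges L.edges
  dX₂L : List.Disjoint X₂.edges L.edges
  /-- `z_i ∈ C̃_{i-1}` -/
  mem : z ∈ A
  /-- the entry route meets `A` at most in `t` -/
  freeE : ∀ x ∈ E.support, x ∈ A → x = t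
  /-- `Z₁` meets `A` only in `z` -/
  freeZ₁ : ∀ x ∈ Z₁.support, x ∈ A → x = z
  /-- canonical: in `F‴` the sausage is non-trivial and `z_i ≠ b̲_i` -/
  canon : z ≠ y ∧ t ≠ y
  /-- (rev. 3) the entry route does not pass through `b̲_i` (the last pivotal bond separates it from the
  sausage). Used to normalise an open class-`1` bond `(w_i, b̲_i)` onto `X₂`. -/
  yfreeE : y ∉ E.support
  /-- (rev. 3) `Z₁` does not pass through `b̲_i` (`z_i ≠ b̲_i` is the first `A`-vertex of a simple route). -/
  yfreeZ₁ : y ∉ Z₁.support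

/-- Constructor of the entry-route coding from the theta configuration: entry route `W₁ ∋ w`, sausage routes
`P₁ ++ P₂` (through `z`) and `Q`, exit walk `L` from `w`. [folklore] -/
theorem LaceCodingMidE.of_theta {η : BondConfig V} {A : Set V} {v y t z w z' : V}
    (W₁ : (openGraph η).Walk v t) (P₁ : (openGraph η).Walk t z) (P₂ : (openGraph η).Walk z y)
    (Q : (openGraph η).Walk t y) (L : (openGraph η).Walk w z')
    (hW₁ : W₁.IsPath) (hP : (P₁.append P₂).IsPath)
    (d1P : List.Disjoint W₁.edges (P₁.append P₂).edges) (d1Q : List.Disjoint W₁.edges Q.edges)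
    (dPQ : List.Disjoint (P₁.append P₂).edges Q.edges) (d1L : List.Disjoint W₁.edges L.edges)
    (dPL : List.Disjoint (P₁.append P₂).edges L.edges) (dQL : List.Disjoint Q.edges L.edges)
    (hW₁A : ∀ x ∈ W₁.support, x ∈ A → x = t) (hzA : z ∈ A) (hfirst : ∀ x ∈ P₁.support, x ∈ A → x = z)
    (hcanon : z = y ↔ t = y) (hw : w ∈ W₁.support) (hne : w ≠ t ∨ t = y)
    (hsharp : t ≠ y → w ≠ y ∧ s(w, y) ∉ η) (hyW₁ : y ∈ W₁.support → t = y) (hQ : Q.IsPath) :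
    Nonempty (LaceCodingMidE η A v y t z w z') := by
  obtain ⟨E₁, E₂, rfl⟩ := Walk.mem_support_iff_exists_append.1 hw
  have hEE := edges_disjoint_of_isPath_append hW₁ rfl
  have hPP := edges_disjoint_of_isPath_append hP rfl
  obtain ⟨hE₁P, hE₂P⟩ := edges_disjoint_pieces rfl d1P
  obtain ⟨hP₁E₁, hP₂E₁⟩ := edges_disjoint_pieces rfl hE₁P.symm
  obtain ⟨hP₁E₂, hP₂E₂⟩ := edges_disjoint_pieces rfl hE₂P.symm
  obtain ⟨hE₁Q, hE₂Q⟩ := edges_disjoint_pieces rfl d1Q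
  obtain ⟨hP₁Q, hP₂Q⟩ := edges_disjoint_pieces rfl dPQ
  obtain ⟨hE₁L, hE₂L⟩ := edges_disjoint_pieces rfl d1L
  obtain ⟨hP₁L, hP₂L⟩ := edges_disjoint_pieces rfl dPL
  have hsub := support_pieces_subset (X := E₁.append E₂) rfl
  have hyE₁ : w ≠ y → y ∉ E₁.support := fun hwy hy =>
    hwy ((isPath_append_iff'.1 hW₁).2.2 y hy (by rw [← hyW₁ (hsub.1 y hy)]; exact E₂.end_mem_support)).symm
  have hnil : t = y → P₁.edges = [] ∧ Q.edges = [] ∧ P₂.edges = [] := by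
    intro hty
    subst hty
    have hPn : P₁.edges ++ P₂.edges = [] := by
      rw [← Walk.edges_append, Walk.eq_nil_iff_nil.2 (Walk.isPath_iff_nil.1 hP), Walk.edges_nil]
    have hQn : Q.edges = [] := by rw [Walk.eq_nil_iff_nil.2 (Walk.isPath_iff_nil.1 hQ), Walk.edges_nil]
    exact ⟨(List.append_eq_nil_iff.1 hPn).1, hQn, (List.append_eq_nil_iff.1 hPn).2⟩
  exact ⟨⟨E₁, E₂, P₁, Q, P₂, L, hEE, hP₁E₁.symm, hE₁Q, hP₂E₁.symm, hE₁L, hP₁E₂.symm, hE₂Q, hP₂E₂.symm,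
    hE₂L, hP₁Q, hPP, hP₁L, hP₂Q.symm, dQL, hP₂L, hzA, fun x hx => hW₁A x (hsub.1 x hx),
    fun x hx => hW₁A x (hsub.2 x hx), hfirst, hcanon, hne, hsharp, hyE₁, hnil⟩⟩

/-- Constructor of the sausage coding from the theta configuration: entry route `W₁`, sausage routes
`P₁ ++ P₂` (through `z`) and `Q ∋ w`, exit walk `L` from `w`. [folklore] -/
theorem LaceCodingMidS.of_theta {η : BondConfig V} {A : Set V} {v y t z w z' : V}
    (W₁ : (openGraph η).Walk v t) (P₁ : (openGraph η).Walk t z) (P₂ : (openGraph η).Walk z y)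
    (Q : (openGraph η).Walk t y) (L : (openGraph η).Walk w z')
    (hP : (P₁.append P₂).IsPath) (hQ : Q.IsPath)
    (d1P : List.Disjoint W₁.edges (P₁.append P₂).edges) (d1Q : List.Disjoint W₁.edges Q.edges)
    (dPQ : List.Disjoint (P₁.append P₂).edges Q.edges) (d1L : List.Disjoint W₁.edges L.edges)
    (dPL : List.Disjoint (P₁.append P₂).edges L.edges) (dQL : List.Disjoint Q.edges L.edges)
    (hW₁A : ∀ x ∈ W₁.support, x ∈ A → x = t) (hzA : z ∈ A) (hfirst : ∀ x ∈ P₁.support, x ∈ A → x = z)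
    (hzy : z ≠ y) (hty : t ≠ y) (hw : w ∈ Q.support) (hyW₁ : y ∉ W₁.support) :
    Nonempty (LaceCodingMidS η A v y t z w z') := by
  obtain ⟨X₁, X₂, rfl⟩ := Walk.mem_support_iff_exists_append.1 hw
  have hyZ₁ : y ∉ P₁.support := fun hy =>
    hzy ((isPath_append_iff'.1 hP).2.2 y hy P₂.end_mem_support).symm
  have hPP := edges_disjoint_of_isPath_append hP rfl
  have hXX := edges_disjoint_of_isPath_append hQ rfl
  obtain ⟨hP₁W, hP₂W⟩ := edges_disjoint_pieces rfl d1P.symm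
  obtain ⟨hX₁W, hX₂W⟩ := edges_disjoint_pieces rfl d1Q.symm
  obtain ⟨hP₁Q, hP₂Q⟩ := edges_disjoint_pieces rfl dPQ
  obtain ⟨hX₁P₁, hX₂P₁⟩ := edges_disjoint_pieces rfl hP₁Q.symm
  obtain ⟨hX₁P₂, hX₂P₂⟩ := edges_disjoint_pieces rfl hP₂Q.symm
  obtain ⟨hP₁L, hP₂L⟩ := edges_disjoint_pieces rfl dPL
  obtain ⟨hX₁L, hX₂L⟩ := edges_disjoint_pieces rfl dQL
  exact ⟨⟨W₁, P₁, X₁, P₂, X₂, L, hP₁W.symm, hX₁W.symm, hP₂W.symm, hX₂W.symm, d1L, hX₁P₁.symm, hPP,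
    hX₂P₁.symm, hP₁L, hX₁P₂, hXX, hX₁L, hX₂P₂.symm, hP₂L, hX₂L, hzA, hW₁A, hfirst, ⟨hzy, hty⟩, hyW₁, hyZ₁⟩⟩

end Coding

/-! ### E. Existence: the coding lemma of a middle level -/

/-- **The coding lemma of a middle level.**  For a configuration using bonds of `ℤ^d`: if `E′(v, y; A)` occurs,
`y' ∉ C̃^{(y,y')}(v)` and `z' ∈ C̃^{(y,y')}(v)`, then for some `t, z, w` the configuration restricted to
`C̃^{(y,y')}(v)` (i.e. `ω ∖ {(y,y')}`) carries an entry-route coding (`F′`/`F″`) or a sausage coding (`F‴`):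
`w` = the last vertex of an open `v → z'` path of `C̃` on the entry route or the sausage; in the first case the
first `A`-vertex `z` is taken on either sausage route, in the second on the route opposite to `w`; when that
vertex is `y` itself the entry route is prolonged to `y` (`t = z = y`, `F′`).
[cite: FitznerVanDerHofstad2017, (4.64) and the paragraph following it; §4.4 after (4.65) (arXiv:1506.07977v2 pp. 42–43; EJP 22 (2017) no. 43 pp. 39–41)] -/
theorem exists_laceCodingMid {ω : BondConfig (Site d)} (hω : ω ⊆ (zdGraph d).edgeSet)
    {A : Set (Site d)} {v y y' z' : Site d} (hE : ω ∈ laceE A v y)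
    (hy' : y' ∉ restrCluster y y' v ω) (hz' : z' ∈ restrCluster y y' v ω) :
    ∃ t z w : Site d, Nonempty (LaceCodingMidE (ω \ {s(y, y')}) A v y t z w z') ∨
      Nonempty (LaceCodingMidS (ω \ {s(y, y')}) A v y t z w z') := by
  classical
  obtain ⟨t, W₁, P, Q, hW₁, hP, hQ, d1P, d1Q, dPQ, hW₁A, h1P, h1Q, hmP, hmQ, hsep⟩ :=
    exists_sausage_sdiff hω hE hy'
  obtain ⟨S⟩ := (mem_restrCluster_iff y y' v z' ω).1 hz'
  -- `F′` from an `A`-free route `R : v → y` with `y ∈ A`: `w` = last vertex of `S` on `R`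
  have codeE₀ : ∀ R : (openGraph (ω \ {s(y, y')})).Walk v y, R.IsPath →
      (∀ x ∈ R.support, x ∈ A → x = y) → y ∈ A →
      ∃ t z w : Site d, Nonempty (LaceCodingMidE (ω \ {s(y, y')}) A v y t z w z') ∨
        Nonempty (LaceCodingMidS (ω \ {s(y, y')}) A v y t z w z') := by
    intro R hR hRA hyA
    obtain ⟨w, S₁, L, -, hwR, hlast⟩ := exists_append_last_mem {x | x ∈ R.support} S
      ⟨v, S.start_mem_support, R.start_mem_support⟩
    have dRL : List.Disjoint R.edges L.edges :=
      LaceGraph.edges_disjoint_of_support L R fun x hx hxR => hlast x hx hxR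
    exact ⟨y, y, w, Or.inl (LaceCodingMidE.of_theta R Walk.nil Walk.nil Walk.nil L hR (by simp) (by simp)
      (by simp) (by simp) dRL (by simp) (by simp) hRA hyA (fun x hx _ => by simpa using hx) Iff.rfl hwR
      (Or.inr rfl) (fun h => absurd rfl h) (fun _ => rfl) Walk.IsPath.nil)⟩
  by_cases hty : t = y
  · -- trivial sausage: `t = y ∈ A`
    subst hty
    have hPnil : P = Walk.nil := Walk.eq_nil_iff_nil.2 (Walk.isPath_iff_nil.1 hP)
    obtain ⟨x, hx, hxA⟩ := hmP
    rw [hPnil, Walk.support_nil, List.mem_singleton] at hx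
    subst hx
    exact codeE₀ W₁ hW₁ hW₁A hxA
  · -- re-coding when the first `A`-vertex of a sausage route is `y` itself: prolong the entry route
    have recode : ∀ R₁ : (openGraph (ω \ {s(y, y')})).Walk t y, R₁.IsPath →
        (∀ x ∈ R₁.support, x ∈ W₁.support → x = t) → (∀ x ∈ R₁.support, x ∈ A → x = y) → y ∈ A →
        ∃ t z w : Site d, Nonempty (LaceCodingMidE (ω \ {s(y, y')}) A v y t z w z') ∨
          Nonempty (LaceCodingMidS (ω \ {s(y, y')}) A v y t z w z') := by
      intro R₁ hR₁ hj hR₁A hyA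
      have htA : t ∉ A := fun htA => hty (hR₁A t R₁.start_mem_support htA)
      refine codeE₀ (W₁.append R₁) (isPath_append_iff'.2 ⟨hW₁, hR₁, fun x hxW hxR => hj x hxR hxW⟩)
        (fun x hx hxA => ?_) hyA
      rw [Walk.mem_support_append_iff] at hx
      rcases hx with hx | hx
      · exact absurd (hW₁A x hx hxA ▸ hxA) htA
      · exact hR₁A x hx hxA
    have hyW : y ∉ W₁.support := fun hyW => hty (h1P y P.end_mem_support hyW).symm
    obtain ⟨zP, P₁, P₂, rfl, hzPA, hfirstP⟩ := exists_append_first_mem A P hmP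
    obtain ⟨zQ, Q₁, Q₂, rfl, hzQA, hfirstQ⟩ := exists_append_first_mem A Q hmQ
    have hsubP := support_pieces_subset (X := P₁.append P₂) rfl
    have hsubQ := support_pieces_subset (X := Q₁.append Q₂) rfl
    by_cases hzPy : zP = y
    · subst hzPy
      exact recode P₁ (LaceGraph.isPath_of_append hP).1 (fun x hx hxW => h1P x (hsubP.1 x hx) hxW) hfirstP hzPA
    by_cases hzQy : zQ = y
    · subst hzQy
      exact recode Q₁ (LaceGraph.isPath_of_append hQ).1 (fun x hx hxW => h1Q x (hsubQ.1 x hx) hxW) hfirstQ hzQA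
    -- generic case: `w` = last vertex of `S` on `W₁ ∪ P ∪ Q`
    obtain ⟨w, S₁, L, -, hwX, hlast⟩ := exists_append_last_mem
      {x | x ∈ W₁.support ∨ x ∈ (P₁.append P₂).support ∨ x ∈ (Q₁.append Q₂).support} S
      ⟨v, S.start_mem_support, Or.inl W₁.start_mem_support⟩
    have dL : ∀ {c c' : Site d} (X : (openGraph (ω \ {s(y, y')})).Walk c c'),
        (∀ x ∈ X.support, x ∈ W₁.support ∨ x ∈ (P₁.append P₂).support ∨ x ∈ (Q₁.append Q₂).support) →
        List.Disjoint X.edges L.edges :=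
      fun X hX => LaceGraph.edges_disjoint_of_support L X fun x hx hxX => hlast x hx (hX x hxX)
    have d1L := dL W₁ fun x hx => Or.inl hx
    have dPL := dL (P₁.append P₂) fun x hx => Or.inr (Or.inl hx)
    have dQL := dL (Q₁.append Q₂) fun x hx => Or.inr (Or.inr hx)
    have onP : w ∈ (P₁.append P₂).support →
        ∃ t z w : Site d, Nonempty (LaceCodingMidE (ω \ {s(y, y')}) A v y t z w z') ∨
          Nonempty (LaceCodingMidS (ω \ {s(y, y')}) A v y t z w z') := fun hwP =>
      ⟨t, zQ, w, Or.inr (LaceCodingMidS.of_theta W₁ Q₁ Q₂ (P₁.append P₂) L hQ hP d1Q d1P dPQ.symm d1L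
        dQL dPL hW₁A hzQA hfirstQ hzQy hty hwP hyW)⟩
    have onQ : w ∈ (Q₁.append Q₂).support →
        ∃ t z w : Site d, Nonempty (LaceCodingMidE (ω \ {s(y, y')}) A v y t z w z') ∨
          Nonempty (LaceCodingMidS (ω \ {s(y, y')}) A v y t z w z') := fun hwQ =>
      ⟨t, zP, w, Or.inr (LaceCodingMidS.of_theta W₁ P₁ P₂ (Q₁.append Q₂) L hP hQ d1P d1Q dPQ d1L
        dPL dQL hW₁A hzPA hfirstP hzPy hty hwQ hyW)⟩
    rcases hwX with hwW | hwP | hwQ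
    · by_cases hwt : w = t
      · exact onP (hwt ▸ (P₁.append P₂).start_mem_support)
      · -- `F″`: the last pivotal bond separates `w` from the sausage, so `w ≠ y` and `(w, y)` is closed
        have hsharp : t ≠ y → w ≠ y ∧ s(w, y) ∉ ω \ {s(y, y')} := by
          refine fun _ => ⟨fun hwy => hyW (hwy ▸ hwW), fun hwy => hwt ?_⟩
          obtain ⟨W₁a, W₁b, hab⟩ := Walk.mem_support_iff_exists_append.1 hwW
          have hW₁b : W₁b.IsPath := (LaceGraph.isPath_of_append (hab ▸ hW₁)).2.1
          have hyb : y ∉ W₁b.support := fun h => hyW (hab ▸ by simp [Walk.mem_support_append_iff, h])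
          have hadj : (openGraph (ω \ {s(y, y')})).Adj w y :=
            (openGraph_adj _ w y).2 ⟨hwy, fun hwy' => hyW (hwy' ▸ hwW)⟩
          have hR : (W₁b.reverse.concat hadj).IsPath := hW₁b.reverse.concat (by simpa using hyb) hadj
          exact hsep _ hR w (by simp) hwW
        exact ⟨t, zP, w, Or.inl (LaceCodingMidE.of_theta W₁ P₁ P₂ (Q₁.append Q₂) L hW₁ hP d1P d1Q dPQ
          d1L dPL dQL hW₁A hzPA hfirstP (iff_of_false hzPy hty) hwW (Or.inl hwt) hsharp (fun h => absurd h hyW)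
          hQ)⟩
    · exact onP hwP
    · exact onQ hwQ

/-- **The four-walk coding inside `C̃^{(y,y')}(v)`** (`NobleCodingLevelOne.LaceCoding`, read in the restricted
configuration): used for a level whose junction to the next level carries no `w`-line.  Same construction,
all routes avoiding `(y,y')`. [cite: FitznerVanDerHofstad2017, §4.4 after (4.65) (arXiv:1506.07977v2 p. 43) and §6.1 Fig. 12 (v2 p. 58)] -/
theorem exists_laceCoding_sdiff {ω : BondConfig (Site d)} (hω : ω ⊆ (zdGraph d).edgeSet)
    {A : Set (Site d)} {v y y' : Site d} (hE : ω ∈ laceE A v y) (hy' : y' ∉ restrCluster y y' v ω) :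
    ∃ t z : Site d, (t = y ↔ z = y) ∧ Nonempty (LaceCoding (ω \ {s(y, y')}) A v y t z) := by
  classical
  obtain ⟨t, W₁, P, Q, hW₁, hP, hQ, d1P, d1Q, dPQ, hW₁A, h1P, -, hmP, -, -⟩ :=
    exists_sausage_sdiff hω hE hy'
  by_cases hty : t = y
  · subst hty
    have hPnil : P = Walk.nil := Walk.eq_nil_iff_nil.2 (Walk.isPath_iff_nil.1 hP)
    obtain ⟨x, hx, hxA⟩ := hmP
    rw [hPnil, Walk.support_nil, List.mem_singleton] at hx
    subst hx
    exact ⟨x, x, Iff.rfl, ⟨⟨W₁, Walk.nil, Walk.nil, Walk.nil, by simp, by simp, by simp, by simp, by simp,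
      by simp, hxA, hW₁A, fun x' hx' _ => by simpa using hx', fun _ => rfl⟩⟩⟩
  obtain ⟨zP, P₁, P₂, rfl, hzPA, hfirstP⟩ := exists_append_first_mem A P hmP
  have hsubP := support_pieces_subset (X := P₁.append P₂) rfl
  have hPP := edges_disjoint_of_isPath_append hP rfl
  obtain ⟨h1P₁, h1P₂⟩ := edges_disjoint_pieces rfl d1P.symm
  obtain ⟨hP₁Q, hP₂Q⟩ := edges_disjoint_pieces rfl dPQ
  by_cases hzPy : zP = y
  · -- prolong the entry route to `y`
    subst hzPy
    have htA : t ∉ A := fun htA => hty (hfirstP t P₁.start_mem_support htA)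
    have hR : (W₁.append P₁).IsPath :=
      isPath_append_iff'.2 ⟨hW₁, (LaceGraph.isPath_of_append hP).1, fun x hxW hxR => h1P x (hsubP.1 x hxR) hxW⟩
    refine ⟨zP, zP, Iff.rfl, ⟨⟨W₁.append P₁, Walk.nil, Walk.nil, Walk.nil, by simp, by simp, by simp, by simp,
      by simp, by simp, hzPA, fun x hx hxA => ?_, fun x' hx' _ => by simpa using hx', fun _ => rfl⟩⟩⟩
    rw [Walk.mem_support_append_iff] at hx
    rcases hx with hx | hx
    · exact absurd (hW₁A x hx hxA ▸ hxA) htA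
    · exact hfirstP x hx hxA
  · exact ⟨t, zP, iff_of_false hty hzPy, ⟨⟨W₁, P₁, Q, P₂, h1P₁.symm, d1Q, h1P₂.symm, hP₁Q, hPP, hP₂Q.symm,
      hzPA, hW₁A, hfirstP, fun h => absurd h hzPy⟩⟩⟩

/-! ### F. Consequences: inside `C̃_i`, cross-level clauses, the typed events -/

namespace LaceCodingMidE

section Generic

variable {V : Type*} {η : BondConfig V} {A : Set V} {v y t z w z' : V}

/-- The six coded connections occur disjointly (the BK-shape of (4.60); for `t = z = y` the three of (4.59)).
[cite: FitznerVanDerHofstad2017, (4.59)–(4.60) (arXiv:1506.07977v2 p. 41)] -/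
theorem mem_disjointOccurrenceList (c : LaceCodingMidE η A v y t z w z') :
    η ∈ disjointOccurrenceList [openConn v w, openConn w t, openConn t z, openConn t y, openConn z y,
      (openConn w z' : Set (BondConfig V))] :=
  mem_disjointOccurrenceList_of_walks6 c.E₁ c.E₂ c.Z₁ c.X c.Z₂ c.L c.dE₁E₂ c.dE₁Z₁ c.dE₁X c.dE₁Z₂ c.dE₁L
    c.dE₂Z₁ c.dE₂X c.dE₂Z₂ c.dE₂L c.dZ₁X c.dZ₁Z₂ c.dZ₁L c.dXZ₂ c.dXL c.dZ₂L

/-- The three connections of `F′`. [cite: FitznerVanDerHofstad2017, (4.59) (arXiv:1506.07977v2 p. 41)] -/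
theorem mem_disjointOccurrenceList₃ (c : LaceCodingMidE η A v y t z w z') :
    η ∈ disjointOccurrenceList [openConn v w, openConn w t, (openConn w z' : Set (BondConfig V))] :=
  mem_disjointOccurrenceList_of_walks₃ c.E₁ c.E₂ c.L c.dE₁E₂ c.dE₁L c.dE₂L

/-- If `z ≠ t` then `t ∉ A`. [folklore] -/
theorem start_notMem (c : LaceCodingMidE η A v y t z w z') (hzt : z ≠ t) : t ∉ A :=
  fun ht => hzt (c.freeZ₁ t c.Z₁.start_mem_support ht).symm

/-- If `w ≠ t` then `w ∉ A`. [folklore] -/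
theorem w_notMem (c : LaceCodingMidE η A v y t z w z') (hwt : w ≠ t) : w ∉ A :=
  fun hw => hwt (c.freeE₁ w c.E₁.end_mem_support hw)

/-- **The cross-level clause.** No bond of `E₁`, `E₂` or `Z₁` has both endpoints in `A`: these walks are
bond-disjoint from every bond set living inside `A` (every previous-level witness inside `C̃_{i-1}`).
[cite: FitznerVanDerHofstad2017, §4.4 after (4.65) (arXiv:1506.07977v2 p. 43)] -/
theorem disjoint_of_forall_mem (c : LaceCodingMidE η A v y t z w z') {K : Set (Sym2 V)}
    (hK : ∀ e ∈ K, ∀ x ∈ e, x ∈ A) :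
    Disjoint {e | e ∈ c.E₁.edges} K ∧ Disjoint {e | e ∈ c.E₂.edges} K ∧ Disjoint {e | e ∈ c.Z₁.edges} K :=
  ⟨disjoint_edges_of_forall_mem c.E₁ t c.freeE₁ hK, disjoint_edges_of_forall_mem c.E₂ t c.freeE₂ hK,
    disjoint_edges_of_forall_mem c.Z₁ z c.freeZ₁ hK⟩

/-- The class-`1` bond `(t, z)` (when `z ≠ t`) is not a bond between two vertices of `A`. [folklore] -/
theorem bond_notMem_of_forall_mem (c : LaceCodingMidE η A v y t z w z') (hzt : z ≠ t) {K : Set (Sym2 V)}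
    (hK : ∀ e ∈ K, ∀ x ∈ e, x ∈ A) : s(t, z) ∉ K :=
  fun h => c.start_notMem hzt (hK _ h t (Sym2.mem_mk_left _ _))

end Generic

variable {ω : BondConfig (Site d)} {A : Set (Site d)} {v y y' t z w z' : Site d}

/-- **All coded walks live inside `C̃^{(y,y')}(v)`** (vertices). [cite: FitznerVanDerHofstad2017, §4.4 after (4.64): "`w_i`, `z_{i+1} ∈ C̃_i`" (arXiv:1506.07977v2 pp. 42–43)] -/
theorem mem_restrCluster (c : LaceCodingMidE (ω \ {s(y, y')}) A v y t z w z') (x : Site d)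
    (hx : x ∈ c.E₁.support ∨ x ∈ c.E₂.support ∨ x ∈ c.Z₁.support ∨ x ∈ c.X.support ∨ x ∈ c.Z₂.support ∨
      x ∈ c.L.support) : x ∈ restrCluster y y' v ω := by
  have hv := self_mem_restrCluster y y' v ω
  have hw : w ∈ restrCluster y y' v ω := mem_restrCluster_of_walk_sdiff c.E₁ hv w c.E₁.end_mem_support
  have ht : t ∈ restrCluster y y' v ω := mem_restrCluster_of_walk_sdiff c.E₂ hw t c.E₂.end_mem_support
  have hz : z ∈ restrCluster y y' v ω := mem_restrCluster_of_walk_sdiff c.Z₁ ht z c.Z₁.end_mem_support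
  rcases hx with hx | hx | hx | hx | hx | hx
  · exact mem_restrCluster_of_walk_sdiff c.E₁ hv x hx
  · exact mem_restrCluster_of_walk_sdiff c.E₂ hw x hx
  · exact mem_restrCluster_of_walk_sdiff c.Z₁ ht x hx
  · exact mem_restrCluster_of_walk_sdiff c.X ht x hx
  · exact mem_restrCluster_of_walk_sdiff c.Z₂ hz x hx
  · exact mem_restrCluster_of_walk_sdiff c.L hw x hx

/-- … (bonds: both endpoints of every bond used lie in `C̃^{(y,y')}(v)`). [cite: FitznerVanDerHofstad2017, §4.4 after (4.65) (arXiv:1506.07977v2 p. 43)] -/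
theorem mem_restrCluster_of_mem_edges (c : LaceCodingMidE (ω \ {s(y, y')}) A v y t z w z') (e : Sym2 (Site d))
    (he : e ∈ c.E₁.edges ∨ e ∈ c.E₂.edges ∨ e ∈ c.Z₁.edges ∨ e ∈ c.X.edges ∨ e ∈ c.Z₂.edges ∨ e ∈ c.L.edges) :
    ∀ x ∈ e, x ∈ restrCluster y y' v ω := by
  have key : ∀ {a b : Site d} (W : (openGraph (ω \ {s(y, y')})).Walk a b),
      (∀ x ∈ W.support, x ∈ restrCluster y y' v ω) → e ∈ W.edges → ∀ x ∈ e, x ∈ restrCluster y y' v ω := by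
    intro a b W hW heW
    induction e using Sym2.ind with
    | h x₁ x₂ =>
      intro x hx
      rcases Sym2.mem_iff.1 hx with rfl | rfl
      · exact hW _ (W.fst_mem_support_of_mem_edges heW)
      · exact hW _ (W.snd_mem_support_of_mem_edges heW)
  rcases he with he | he | he | he | he | he
  · exact key c.E₁ (fun x hx => c.mem_restrCluster x (Or.inl hx)) he
  · exact key c.E₂ (fun x hx => c.mem_restrCluster x (Or.inr (Or.inl hx))) he
  · exact key c.Z₁ (fun x hx => c.mem_restrCluster x (Or.inr (Or.inr (Or.inl hx)))) he
  · exact key c.X (fun x hx => c.mem_restrCluster x (Or.inr (Or.inr (Or.inr (Or.inl hx))))) he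
  · exact key c.Z₂ (fun x hx => c.mem_restrCluster x (Or.inr (Or.inr (Or.inr (Or.inr (Or.inl hx)))))) he
  · exact key c.L (fun x hx => c.mem_restrCluster x (Or.inr (Or.inr (Or.inr (Or.inr (Or.inr hx)))))) he

/-- `t, z, w, z' ∈ C̃^{(y,y')}(v)`; hence none of them is `y'` when `y' ∉ C̃^{(y,y')}(v)` (in particular
`z_{i+1} ≠ b̄_i`, half of the clause `z_{i+1} ∉ b_i`). [cite: FitznerVanDerHofstad2017, (4.59)–(4.61) clause `z_{i+1} ∉ b_i` (arXiv:1506.07977v2 p. 41)] -/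
theorem ne_of_notMem (c : LaceCodingMidE (ω \ {s(y, y')}) A v y t z w z') (hy' : y' ∉ restrCluster y y' v ω) :
    t ≠ y' ∧ z ≠ y' ∧ w ≠ y' ∧ z' ≠ y' :=
  ⟨ne_of_mem_of_not_mem (c.mem_restrCluster t (Or.inr (Or.inl c.E₂.end_mem_support))) hy',
    ne_of_mem_of_not_mem (c.mem_restrCluster z (Or.inr (Or.inr (Or.inl c.Z₁.end_mem_support)))) hy',
    ne_of_mem_of_not_mem (c.mem_restrCluster w (Or.inl c.E₁.end_mem_support)) hy',
    ne_of_mem_of_not_mem (c.mem_restrCluster z' (Or.inr (Or.inr (Or.inr (Or.inr (Or.inr c.L.end_mem_support)))))) hy'⟩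

variable {η : BondConfig (Site d)}

/-- With all bonds at `u ≠ v` vacant, `u ∉ {t, w, z, y}` (the clause `b̲_{i-1} ∉ {t_i,w_i,z_i,b̲_i}`).
[cite: FitznerVanDerHofstad2017, (4.59)–(4.60) (arXiv:1506.07977v2 p. 41)] -/
theorem u_notMem (c : LaceCodingMidE η A v y t z w z') {u : Site d} (huv : u ≠ v) (hvac : η ∈ eventVac u) :
    u ∉ ({t, w, z, y} : Set (Site d)) := by
  have hvw : η ∈ (openConn v w : Set (BondConfig (Site d))) := c.E₁.reachable
  have hvt : η ∈ (openConn v t : Set (BondConfig (Site d))) := (c.E₁.append c.E₂).reachable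
  have hvz : η ∈ (openConn v z : Set (BondConfig (Site d))) := ((c.E₁.append c.E₂).append c.Z₁).reachable
  have hvy : η ∈ (openConn v y : Set (BondConfig (Site d))) := ((c.E₁.append c.E₂).append c.X).reachable
  simp only [Set.mem_insert_iff, Set.mem_singleton_iff, not_or]
  refine ⟨?_, ?_, ?_, ?_⟩ <;> rintro rfl
  · exact huv (eq_of_mem_eventVac_of_mem_openConn hvac hvt).symm
  · exact huv (eq_of_mem_eventVac_of_mem_openConn hvac hvw).symm
  · exact huv (eq_of_mem_eventVac_of_mem_openConn hvac hvz).symm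
  · exact huv (eq_of_mem_eventVac_of_mem_openConn hvac hvy).symm

/-- **Sharpness read in the raw configuration** (rev. 2): on `F″` (`t ≠ y`) the exit pair `(b̲_i, w_i)` has
line class `2` in `ω_i` itself — `w ≠ y` and the bond `(y, w)` is closed (it is neither a bond at the vacant
vertex `u` nor the pivotal bond `(y, y')`, so closed in the restricted configuration means closed).
[cite: FitznerVanDerHofstad2017, (4.60) with §4.4 after (4.64) (arXiv:1506.07977v2 pp. 41–42)] -/
theorem sharp_raw {ω : BondConfig (Site d)} {u : Site d}
    (c : LaceCodingMidE (offBonds (bondsAt {u}) ω \ {s(y, y')}) A v y t z w z') (huv : u ≠ v)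
    (hvac : offBonds (bondsAt {u}) ω \ {s(y, y')} ∈ eventVac u)
    (hy' : y' ∉ restrCluster y y' v (offBonds (bondsAt {u}) ω)) (hty : t ≠ y) :
    y ≠ w ∧ s(y, w) ∉ ω := by
  obtain ⟨hwy, hcl⟩ := c.sharp hty
  have hu := c.u_notMem huv hvac
  simp only [Set.mem_insert_iff, Set.mem_singleton_iff, not_or] at hu
  refine ⟨fun h => hwy h.symm, fun hmem => hcl ⟨⟨by rwa [Sym2.eq_swap], fun hm => ?_⟩, fun hm => ?_⟩⟩
  · rw [mem_bondsAt_singleton_iff, Sym2.mem_iff] at hm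
    rcases hm with h | h
    · exact hu.2.1 h
    · exact hu.2.2.2 h
  · rw [Set.mem_singleton_iff, Sym2.eq_iff] at hm
    rcases hm with ⟨h, -⟩ | ⟨h, -⟩
    · exact hwy h
    · exact (c.ne_of_notMem hy').2.2.1 h

/-- **Bridge to the typed `F′ ∪ F″`** ((4.59)–(4.60)): with all bonds at `u ≠ v` vacant and `z' ∉ (y, y')`, the
coded configuration lies in `F′` (if `t = y`) or `F″` (if `t ≠ y`).
[cite: FitznerVanDerHofstad2017, (4.59), (4.60), (4.64) (arXiv:1506.07977v2 pp. 41–42)] -/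
theorem mem_eventF (c : LaceCodingMidE η A v y t z w z') {u y'' : Site d} (huv : u ≠ v)
    (hvac : η ∈ eventVac u) (hz'b : z' ∉ s(y, y'')) : η ∈ eventF u v t z y y'' w z' := by
  by_cases hty : t = y
  · have hzy : z = y := c.canon.2 hty
    refine Or.inl (Or.inl ⟨⟨⟨?_, hzy, hty.symm⟩, hz'b⟩, c.u_notMem huv hvac⟩)
    have h := c.mem_disjointOccurrenceList₃
    rw [hty] at h
    exact h
  · exact Or.inl (Or.inr ⟨⟨⟨⟨c.mem_disjointOccurrenceList, fun h => hty (c.canon.1 h)⟩,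
      c.ne.resolve_right hty⟩, hz'b⟩, c.u_notMem huv hvac⟩)

end LaceCodingMidE

namespace LaceCodingMidS

section Generic

variable {V : Type*} {η : BondConfig V} {A : Set V} {v y t z w z' : V}

/-- The six coded connections occur disjointly (the BK-shape of (4.61)).
[cite: FitznerVanDerHofstad2017, (4.61) (arXiv:1506.07977v2 p. 41)] -/
theorem mem_disjointOccurrenceList (c : LaceCodingMidS η A v y t z w z') :
    η ∈ disjointOccurrenceList [openConn v t, openConn t z, openConn t w, openConn z y, openConn w y,
      (openConn w z' : Set (BondConfig V))] :=
  mem_disjointOccurrenceList_of_walks6 c.E c.Z₁ c.X₁ c.Z₂ c.X₂ c.L c.dEZ₁ c.dEX₁ c.dEZ₂ c.dEX₂ c.dEL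
    c.dZ₁X₁ c.dZ₁Z₂ c.dZ₁X₂ c.dZ₁L c.dX₁Z₂ c.dX₁X₂ c.dX₁L c.dZ₂X₂ c.dZ₂L c.dX₂L

/-- If `z ≠ t` then `t ∉ A`. [folklore] -/
theorem start_notMem (c : LaceCodingMidS η A v y t z w z') (hzt : z ≠ t) : t ∉ A :=
  fun ht => hzt (c.freeZ₁ t c.Z₁.start_mem_support ht).symm

/-- **The cross-level clause.** No bond of `E` or `Z₁` has both endpoints in `A`.
[cite: FitznerVanDerHofstad2017, §4.4 after (4.65) (arXiv:1506.07977v2 p. 43)] -/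
theorem disjoint_of_forall_mem (c : LaceCodingMidS η A v y t z w z') {K : Set (Sym2 V)}
    (hK : ∀ e ∈ K, ∀ x ∈ e, x ∈ A) :
    Disjoint {e | e ∈ c.E.edges} K ∧ Disjoint {e | e ∈ c.Z₁.edges} K :=
  ⟨disjoint_edges_of_forall_mem c.E t c.freeE hK, disjoint_edges_of_forall_mem c.Z₁ z c.freeZ₁ hK⟩

/-- The class-`1` bond `(t, z)` (when `z ≠ t`) is not a bond between two vertices of `A`. [folklore] -/
theorem bond_notMem_of_forall_mem (c : LaceCodingMidS η A v y t z w z') (hzt : z ≠ t) {K : Set (Sym2 V)}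
    (hK : ∀ e ∈ K, ∀ x ∈ e, x ∈ A) : s(t, z) ∉ K :=
  fun h => c.start_notMem hzt (hK _ h t (Sym2.mem_mk_left _ _))

end Generic

variable {ω : BondConfig (Site d)} {A : Set (Site d)} {v y y' t z w z' : Site d}

/-- **All coded walks live inside `C̃^{(y,y')}(v)`** (vertices). [cite: FitznerVanDerHofstad2017, §4.4 after (4.64) (arXiv:1506.07977v2 pp. 42–43)] -/
theorem mem_restrCluster (c : LaceCodingMidS (ω \ {s(y, y')}) A v y t z w z') (x : Site d)
    (hx : x ∈ c.E.support ∨ x ∈ c.Z₁.support ∨ x ∈ c.X₁.support ∨ x ∈ c.Z₂.support ∨ x ∈ c.X₂.support ∨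
      x ∈ c.L.support) : x ∈ restrCluster y y' v ω := by
  have hv := self_mem_restrCluster y y' v ω
  have ht : t ∈ restrCluster y y' v ω := mem_restrCluster_of_walk_sdiff c.E hv t c.E.end_mem_support
  have hz : z ∈ restrCluster y y' v ω := mem_restrCluster_of_walk_sdiff c.Z₁ ht z c.Z₁.end_mem_support
  have hw : w ∈ restrCluster y y' v ω := mem_restrCluster_of_walk_sdiff c.X₁ ht w c.X₁.end_mem_support
  rcases hx with hx | hx | hx | hx | hx | hx
  · exact mem_restrCluster_of_walk_sdiff c.E hv x hx
  · exact mem_restrCluster_of_walk_sdiff c.Z₁ ht x hx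
  · exact mem_restrCluster_of_walk_sdiff c.X₁ ht x hx
  · exact mem_restrCluster_of_walk_sdiff c.Z₂ hz x hx
  · exact mem_restrCluster_of_walk_sdiff c.X₂ hw x hx
  · exact mem_restrCluster_of_walk_sdiff c.L hw x hx

/-- … (bonds). [cite: FitznerVanDerHofstad2017, §4.4 after (4.65) (arXiv:1506.07977v2 p. 43)] -/
theorem mem_restrCluster_of_mem_edges (c : LaceCodingMidS (ω \ {s(y, y')}) A v y t z w z') (e : Sym2 (Site d))
    (he : e ∈ c.E.edges ∨ e ∈ c.Z₁.edges ∨ e ∈ c.X₁.edges ∨ e ∈ c.Z₂.edges ∨ e ∈ c.X₂.edges ∨ e ∈ c.L.edges) :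
    ∀ x ∈ e, x ∈ restrCluster y y' v ω := by
  have key : ∀ {a b : Site d} (W : (openGraph (ω \ {s(y, y')})).Walk a b),
      (∀ x ∈ W.support, x ∈ restrCluster y y' v ω) → e ∈ W.edges → ∀ x ∈ e, x ∈ restrCluster y y' v ω := by
    intro a b W hW heW
    induction e using Sym2.ind with
    | h x₁ x₂ =>
      intro x hx
      rcases Sym2.mem_iff.1 hx with rfl | rfl
      · exact hW _ (W.fst_mem_support_of_mem_edges heW)
      · exact hW _ (W.snd_mem_support_of_mem_edges heW)
  rcases he with he | he | he | he | he | he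
  · exact key c.E (fun x hx => c.mem_restrCluster x (Or.inl hx)) he
  · exact key c.Z₁ (fun x hx => c.mem_restrCluster x (Or.inr (Or.inl hx))) he
  · exact key c.X₁ (fun x hx => c.mem_restrCluster x (Or.inr (Or.inr (Or.inl hx)))) he
  · exact key c.Z₂ (fun x hx => c.mem_restrCluster x (Or.inr (Or.inr (Or.inr (Or.inl hx))))) he
  · exact key c.X₂ (fun x hx => c.mem_restrCluster x (Or.inr (Or.inr (Or.inr (Or.inr (Or.inl hx)))))) he
  · exact key c.L (fun x hx => c.mem_restrCluster x (Or.inr (Or.inr (Or.inr (Or.inr (Or.inr hx)))))) he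

/-- `t, z, w, z' ≠ y'` when `y' ∉ C̃^{(y,y')}(v)`. [cite: FitznerVanDerHofstad2017, (4.61) clause `z_{i+1} ∉ b_i` (arXiv:1506.07977v2 p. 41)] -/
theorem ne_of_notMem (c : LaceCodingMidS (ω \ {s(y, y')}) A v y t z w z') (hy' : y' ∉ restrCluster y y' v ω) :
    t ≠ y' ∧ z ≠ y' ∧ w ≠ y' ∧ z' ≠ y' :=
  ⟨ne_of_mem_of_not_mem (c.mem_restrCluster t (Or.inl c.E.end_mem_support)) hy',
    ne_of_mem_of_not_mem (c.mem_restrCluster z (Or.inr (Or.inl c.Z₁.end_mem_support))) hy',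
    ne_of_mem_of_not_mem (c.mem_restrCluster w (Or.inr (Or.inr (Or.inl c.X₁.end_mem_support)))) hy',
    ne_of_mem_of_not_mem (c.mem_restrCluster z' (Or.inr (Or.inr (Or.inr (Or.inr (Or.inr c.L.end_mem_support)))))) hy'⟩

variable {η : BondConfig (Site d)}

/-- With all bonds at `u ≠ v` vacant, `u ∉ {t, w, z, y}`. [cite: FitznerVanDerHofstad2017, (4.61) (arXiv:1506.07977v2 p. 41)] -/
theorem u_notMem (c : LaceCodingMidS η A v y t z w z') {u : Site d} (huv : u ≠ v) (hvac : η ∈ eventVac u) :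
    u ∉ ({t, w, z, y} : Set (Site d)) := by
  have hvt : η ∈ (openConn v t : Set (BondConfig (Site d))) := c.E.reachable
  have hvw : η ∈ (openConn v w : Set (BondConfig (Site d))) := (c.E.append c.X₁).reachable
  have hvz : η ∈ (openConn v z : Set (BondConfig (Site d))) := (c.E.append c.Z₁).reachable
  have hvy : η ∈ (openConn v y : Set (BondConfig (Site d))) := ((c.E.append c.X₁).append c.X₂).reachable
  simp only [Set.mem_insert_iff, Set.mem_singleton_iff, not_or]
  refine ⟨?_, ?_, ?_, ?_⟩ <;> rintro rfl
  · exact huv (eq_of_mem_eventVac_of_mem_openConn hvac hvt).symm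
  · exact huv (eq_of_mem_eventVac_of_mem_openConn hvac hvw).symm
  · exact huv (eq_of_mem_eventVac_of_mem_openConn hvac hvz).symm
  · exact huv (eq_of_mem_eventVac_of_mem_openConn hvac hvy).symm

/-- **Bridge to the typed `F‴`** ((4.61)). [cite: FitznerVanDerHofstad2017, (4.61), (4.64) (arXiv:1506.07977v2 pp. 41–42)] -/
theorem mem_eventF (c : LaceCodingMidS η A v y t z w z') {u y'' : Site d} (huv : u ≠ v)
    (hvac : η ∈ eventVac u) (hz'b : z' ∉ s(y, y'')) : η ∈ eventF u v t z y y'' w z' :=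
  Or.inr ⟨⟨⟨c.mem_disjointOccurrenceList, c.canon.1⟩, hz'b⟩, c.u_notMem huv hvac⟩

end LaceCodingMidS

/-! ### G. Corollaries in the shape of the tree's (4.64) -/

/-- **(4.64) with the coding clauses**: in `E′(v,y;A) ∩ {y' ∉ C̃} ∩ {z' ∈ C̃} ∩ E_vac(u)` (`u ≠ v`, `z' ≠ y`) the
restricted configuration `ω ∖ {(y,y')}` lies in `F((u,v),t,z,(y,y'),w,z')` for a CODED triple `(t,z,w)` — the
tree's `exists_mem_eventF_of_mem_laceE`, now with `z ∈ A` attained as a first `A`-vertex, the entry route off `A`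
and everything inside `C̃`. [cite: FitznerVanDerHofstad2017, (4.64) (arXiv:1506.07977v2 p. 42)] -/
theorem exists_mem_eventF_coded {ω : BondConfig (Site d)} (hω : ω ⊆ (zdGraph d).edgeSet)
    {A : Set (Site d)} {u v y y' z' : Site d} (huv : u ≠ v) (hE : ω ∈ laceE A v y)
    (hy' : y' ∉ restrCluster y y' v ω) (hz' : z' ∈ restrCluster y y' v ω) (hz'y : z' ≠ y)
    (hvac : ω ∈ eventVac u) :
    ∃ t z w : Site d, (Nonempty (LaceCodingMidE (ω \ {s(y, y')}) A v y t z w z') ∨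
      Nonempty (LaceCodingMidS (ω \ {s(y, y')}) A v y t z w z')) ∧
      ω \ {s(y, y')} ∈ eventF u v t z y y' w z' := by
  obtain ⟨t, z, w, h⟩ := exists_laceCodingMid hω hE hy' hz'
  have hvac' : ω \ {s(y, y')} ∈ eventVac u := fun e he => hvac e he.1
  refine ⟨t, z, w, h, ?_⟩
  rcases h with hc | hc
  · obtain ⟨c⟩ := hc
    have hzb : z' ∉ s(y, y') := by
      rw [Sym2.mem_iff, not_or]; exact ⟨hz'y, (c.ne_of_notMem hy').2.2.2⟩
    exact c.mem_eventF huv hvac' hzb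
  · obtain ⟨c⟩ := hc
    have hzb : z' ∉ s(y, y') := by
      rw [Sym2.mem_iff, not_or]; exact ⟨hz'y, (c.ne_of_notMem hy').2.2.2⟩
    exact c.mem_eventF huv hvac' hzb

/-- The coding lemma on the NoBLE cell as typed (`nobleCell B A′ A v y y'`: `E′(v,y;A)` off `B` and
`y' ∉ C̃^{(y,y')}(v) ∪ A′`), for `z' ∈ C̃^{(y,y')}(v)` read off `B`.
[cite: FitznerVanDerHofstad2017, (3.25)–(3.27), (4.64) (arXiv:1506.07977v2 pp. 25–27, 42)] -/
theorem exists_laceCodingMid_of_mem_nobleCell {ω : BondConfig (Site d)} (hω : ω ⊆ (zdGraph d).edgeSet)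
    {B : Set (Sym2 (Site d))} {A' A : Set (Site d)} {v y y' z' : Site d} (h : ω ∈ nobleCell B A' A v y y')
    (hz' : z' ∈ restrCluster y y' v (offBonds B ω)) :
    ∃ t z w : Site d, Nonempty (LaceCodingMidE (offBonds B ω \ {s(y, y')}) A v y t z w z') ∨
      Nonempty (LaceCodingMidS (offBonds B ω \ {s(y, y')}) A v y t z w z') :=
  exists_laceCodingMid ((offBonds_subset B ω).trans hω) h.1 (fun hy => h.2 (Or.inl hy)) hz'

/-- The four-walk coding on the NoBLE cell as typed. [cite: FitznerVanDerHofstad2017, (3.25)–(3.27), §4.4 after (4.65) (arXiv:1506.07977v2 pp. 25–27, 43)] -/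
theorem exists_laceCoding_sdiff_of_mem_nobleCell {ω : BondConfig (Site d)} (hω : ω ⊆ (zdGraph d).edgeSet)
    {B : Set (Sym2 (Site d))} {A' A : Set (Site d)} {v y y' : Site d} (h : ω ∈ nobleCell B A' A v y y') :
    ∃ t z : Site d, (t = y ↔ z = y) ∧ Nonempty (LaceCoding (offBonds B ω \ {s(y, y')}) A v y t z) :=
  exists_laceCoding_sdiff ((offBonds_subset B ω).trans hω) h.1 fun hy => h.2 (Or.inl hy)

end Literature.Probability.FitznerVanDerHofstad2017
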